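import Literature.NumberTheory.EllipticCurves.KuriharaNumber
import Literature.NumberTheory.EllipticCurves.CuspFormLFunction
import Literature.NumberTheory.EllipticCurves.LeadingTermPPartProofs
import HarnessLib

/-!
# BirchSwinnertonDyer / SelmerRank — crux `SelmerRankLB` (stmt-BirchSwinnertonDyer-0131),
# line `kurihara_order`, stub **V0** `stub_delta_one`

Registered stub **V0** of the skeleton `Cruxes/SelmerRankLB/Lines/kurihara_order.lean`: the bottom
Kurihara number vanishes as soon as the analytic rank is positive. For the newform `f` of level
`N_E` attached to an elliptic `W/ℚ`, every prime `p`, every level `k` and every choice of discrete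
logarithms `ψ`,

  `1 ≤ r_an(W) ⟹ kuriharaNumber f (p^k) 1 ψ = 0`.

Proof (Kurihara 2014, §1.1: `δ̃_1 = [0]⁺ = L(E,1)/Ω⁺_E`; assembled from tree theorems):

* `kuriharaNumber f m 1 ψ = \overline{[0]⁺_f}` (`kuriharaNumber_one`, the level-`1` sum has the
  single term `a = 0` and the empty product);
* `L(E,1) = [0]⁺_f · Ω⁺_f` in `ℂ` (`IsNewformOf.entireLFunction_one_eq`: Manin's `{∞,0}_f = L(f,1)`,
  modularity `L(f,s) = L(E,s)`, Manin–Drinfeld rationality of `[0]⁺_f`);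
* `Ω⁺_f > 0` (`IsNewform0.plusPeriod_pos_holds`, the coefficient field of `f` being `ℚ` by
  `IsNewformOf.coeffField_eq_bot`);
* `r_an(W) = analyticOrderNatAt (entireLFunction W) 1 ≥ 1` forces `L(E,1) = 0`
  (Mathlib `apply_eq_zero_of_analyticOrderNatAt_ne_zero`);
* hence `[0]⁺_f = 0` in `ℚ` and `\overline{0} = 0` (`ratModP_zero`).
-/

set_option linter.dupNamespace false

noncomputable section

namespace Summit.BirchSwinnertonDyer.BirchSwinnertonDyer.Theorems

open scoped MatrixGroups ModularForm

open CongruenceSubgroup Literature.NumberTheory.EllipticCurves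
  Literature.NumberTheory.EllipticCurves.ModularForms

/-- **`L(E,1) = 0` once `r_an ≥ 1`.** The analytic rank is *defined* as
`analyticOrderNatAt W.entireLFunction 1`, and a function vanishes at a point where its analytic
order (as a natural number) is nonzero (Mathlib `apply_eq_zero_of_analyticOrderNatAt_ne_zero`).
[folklore] -/
theorem deltaOne_entireLFunction_one_eq_zero (W : WeierstrassCurve ℚ) (hr : 1 ≤ W.analyticRank) :
    W.entireLFunction 1 = 0 := by
  apply apply_eq_zero_of_analyticOrderNatAt_ne_zero
  unfold WeierstrassCurve.analyticRank at hr
  omega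

/-- **`[0]⁺_f = 0` once `r_an ≥ 1`**, for the newform `f` of an elliptic `W/ℚ` (any level `N ≥ 1`):
`L(E,1) = [0]⁺_f · Ω⁺_f` (`IsNewformOf.entireLFunction_one_eq`, Mazur–Tate–Teitelbaum 1986 §I.8)
with `Ω⁺_f > 0` (`IsNewform0.plusPeriod_pos_holds`) and `L(E,1) = 0`. Kurihara 2014, §1.1:
"`δ̃_1 = [0]⁺ = L(E,1)/Ω⁺_E`". [cite: Kurihara2014, §1.1 (PDF p. 2)] -/
theorem deltaOne_ratPlusSymbol_zero_eq_zero {W : WeierstrassCurve ℚ} [W.IsElliptic] {N : ℕ} [NeZero N]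
    {f : CuspForm (Gamma0 N) 2} (hf : IsNewformOf W f) (hr : 1 ≤ W.analyticRank) :
    ratPlusSymbol f 0 = 0 := by
  have hpos : 0 < plusPeriod f := IsNewform0.plusPeriod_pos_holds hf.1 hf.coeffField_eq_bot
  have hL : W.entireLFunction 1 = ((((ratPlusSymbol f 0 : ℚ) : ℝ) * plusPeriod f : ℝ) : ℂ) :=
    hf.entireLFunction_one_eq
  rw [deltaOne_entireLFunction_one_eq_zero W hr] at hL
  have hreal : ((ratPlusSymbol f 0 : ℚ) : ℝ) * plusPeriod f = 0 := by
    exact_mod_cast hL.symm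
  have hcast : ((ratPlusSymbol f 0 : ℚ) : ℝ) = 0 :=
    (mul_eq_zero.mp hreal).resolve_right hpos.ne'
  exact_mod_cast hcast

/-- Stub **V0** (`stub_delta_one`) — **`r_an ≥ 1 ⇒ δ_1 = 0`.** For the newform `f` of `W` at level
`N_E` and every modulus `p^k` and choice of logarithms `ψ`,
`kuriharaNumber f (p^k) 1 ψ = \overline{[0]⁺_f}` (`kuriharaNumber_one`) and `[0]⁺_f = 0` because
`L(E,1) = [0]⁺_f · Ω⁺_f` (`IsNewformOf.entireLFunction_one_eq`) with `Ω⁺_f > 0`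
(`IsNewform0.plusPeriod_pos_holds`) while `L(E,1) = entireLFunction W 1 = 0` as soon as
`r_an = analyticOrderNatAt (entireLFunction W) 1 ≥ 1`. Kurihara 2014, §1.1
(`δ̃_1 = θ_ℚ = L(E,1)/Ω⁺_E`); Kim 2022, §1.4.3. [cite: Kurihara2014, §1.1 (PDF p. 2)] -/
theorem stub_delta_one :
    ∀ (W : WeierstrassCurve ℚ) [W.IsElliptic] [W.IsGloballyMinimal] (p : ℕ) [Fact p.Prime]
      (_ : NeZero (W.conductorNorm ℤ)) (f : CuspForm (Gamma0 (W.conductorNorm ℤ)) 2),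
      IsNewformOf W f → 1 ≤ W.analyticRank →
      ∀ (k : ℕ) (ψ : (ℓ : ℕ) → (ZMod ℓ)ˣ →* Multiplicative (ZMod (p ^ k))),
        kuriharaNumber f (p ^ k) 1 ψ = 0 := by
  intro W _ _ p _ hN f hf hr k ψ
  rw [kuriharaNumber_one, deltaOne_ratPlusSymbol_zero_eq_zero hf hr, ratModP_zero]

end Summit.BirchSwinnertonDyer.BirchSwinnertonDyer.Theorems

end
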